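import Literature.Analysis.Fourier.BeurlingFunction
import Literature.Analysis.Fourier.DirichletIntegral
import Literature.Analysis.Fourier.SincSmooth
import Literature.NumberTheory.Sieve.LargeSieveInequality
import Mathlib.Analysis.SpecialFunctions.Trigonometric.Bounds
import HarnessLib

/-!
# Vaaler's function `H = B − K`: integral representation on the real line and the Fourier form of `H′` (Vaaler 1985, Thm 6)

Topic `Literature/Analysis/Fourier`, next to `BeurlingFunction.lean` (Beurling's `B`, `sincPi`, the
periodisation `Σ sincPi(z+n)² = 1`) and `DirichletIntegral.lean` (Dirichlet's integral and the sine
form of the Riemann–Lebesgue lemma). Everything here is PROVED; no definitions, no named facts.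
Written by the literature-typing seat `littype-FP2-1` (cell `parity-realchar`, D-0088 (4) row (7)) as the
Fourier-analytic input of Ramaré's second smoothing for even characters (O. Ramaré, *Approximate
formulae for `L(1, χ)`*, Acta Arith. 100 (2001) 245–266, Prop. 2 with `F₃` and Lemma 16), whose `F₃` IS
Vaaler's `H` (Ramaré (1.8): `F₃(t) = (sin πt/π)²(Σ_m sgn(m)/(t−m)² + 2/t)`).

J. D. Vaaler, *Some extremal functions in Fourier analysis*, Bull. AMS 12 (1985) 183–216, §2 (2.22)–(2.23)
and **Theorem 6**: with `K(z) = (sin πz/πz)²`, `H(z) = (sin πz/π)²{Σ_n sgn(n)/(z−n)² + 2/z}`,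
`J = ½H′`, one has `H + K = B` (Beurling's function), and «The Fourier transform of `J(x)` is given by
`Ĵ(t) = πt(1−|t|)cot πt + |t|` for `|t| < 1`, `0` for `|t| ≥ 1`» ((2.30); held text
`paper:doi-10-1090-s0273-0979-1985-15349-2`, chunk 12 — the OCR drops the display, the statement is the
standard one, cf. Ramaré's `ϱ₃ = j` with `j(t) = 2∫_{|t|}^1 (π(1−u)cot πu + 1) du`, Lemma 7 p. 253).

## What is proved (real-variable form; `H(x) := beurlingReal x − sinc(πx)²`)

* `two_mul_integral_tent_cos` — the tent transform `2∫₀¹ (1−t)cos(2πyt) dt = sinc(πy)²`;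
* `sum_sinc_sq_add_eq`, `tendsto_dirichletTentIntegral`, `hasSum_sinc_sq_add_dirichlet` —
  `Σ_{n≥1} sinc(π(x+n))² = ½ − ∫₀¹ (1−t) sin((2x+1)πt)/sin(πt) dt` (Dirichlet kernel; the limit
  `∫₀¹ (1−t) sin(Mπt)/sin πt dt → ½` by Dirichlet's integral for `1/(πt)` plus Riemann–Lebesgue for the
  bounded remainder `(1−t)/sin πt − 1/(πt)`);
* **`beurlingReal_sub_sinc_sq`** — `H(x) = 2x·sinc(πx)² + 2∫₀¹ (1−t)cot(πt) sin(2πxt) dt` for all real `x`;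
* **`hasDerivAt_beurlingReal_sub_sinc_sq`** (Vaaler's Theorem 6) — `H′(x) = W(x)`,
  `W(x) := 4∫₀¹ (t + πt(1−t)cot πt) cos(2πxt) dt` `= ∫_{−1}^{1} 2Ĵ(t) e(xt) dt`; `vaalerW_zero` (`W(0) = 2`),
  `vaalerW_neg` (even), `abs_vaalerW_le` (`|W| ≤ 12`);
* **`abs_vaalerW_le_div_sq`**, `abs_vaalerW_le_div_one_add_sq` — `|W(x)| ≤ 8e^{2π}/x²` (`|x| ≥ 2`),
  `|W(x)| ≤ 10e^{2π}/(1+x²)`: Cauchy's estimate (`Complex.norm_deriv_le_of_forall_mem_sphere_norm_le`) on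
  the circle of radius `1` for the entire `B − sincPi²`, using the tree's growth bounds
  `norm_beurling_sub_one_le`, `norm_sincPi_le_div`;
* `beurlingReal_sub_sinc_sq_natCast` (`H(n) = 1`, `n ≥ 1`), `one_sub_beurlingReal_sub_sinc_sq_nonneg` /
  `_le` (`0 ≤ 1 − H(x) ≤ sinc(πx)²` for `x > 0`; Vaaler Lemma 5 / Ramaré Lemma 15).

No new notions: `W` and the weight `t + πt(1−t)cot πt` are written out (as `cos/sin`) in each statement.

## References

* [Vaaler1985] J. D. Vaaler, Bull. AMS 12 (1985), §2 (2.22)–(2.30), Lemma 5, Thm 6. [cite: Vaaler1985, Thm. 6]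
* [Ramare2001LOneApproximateFormulae] O. Ramaré, Acta Arith. 100 (2001), (1.8)–(1.9), Lemma 7, Lemma 15.
-/

noncomputable section

open Real Filter Topology Set MeasureTheory intervalIntegral

namespace Literature.Analysis.Fourier

open Literature.NumberTheory.Sieve.LargeSieve (two_mul_le_sin_pi_mul)

/-! ## The tent transform `2∫₀¹ (1−t) cos(2πyt) dt = sinc(πy)²` -/

/-- `∫₀¹ (1 − t) cos(c t) dt = (1 − cos c)/c²` for `c ≠ 0`. [cite: Vaaler1985, §2 (2.29)] -/
theorem integral_one_sub_mul_cos {c : ℝ} (hc : c ≠ 0) :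
    ∫ t in (0:ℝ)..1, (1 - t) * Real.cos (c * t) = (1 - Real.cos c) / c ^ 2 := by
  have hderiv : ∀ t ∈ uIcc (0:ℝ) 1,
      HasDerivAt (fun t => (1 - t) * Real.sin (c * t) / c - Real.cos (c * t) / c ^ 2)
        ((1 - t) * Real.cos (c * t)) t := by
    intro t _
    have h1 : HasDerivAt (fun t => Real.sin (c * t)) (Real.cos (c * t) * c) t :=
      ((hasDerivAt_id t).const_mul c |>.sin).congr_deriv (by simp [mul_comm])
    have h2 : HasDerivAt (fun t => Real.cos (c * t)) (-Real.sin (c * t) * c) t :=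
      ((hasDerivAt_id t).const_mul c |>.cos).congr_deriv (by simp [mul_comm])
    have h3 : HasDerivAt (fun t : ℝ => (1 - t)) (-1) t := by
      simpa using (hasDerivAt_id t).const_sub 1
    have h4 := ((h3.mul h1).div_const c).sub (h2.div_const (c ^ 2))
    refine h4.congr_deriv ?_
    field_simp
    ring
  rw [integral_eq_sub_of_hasDerivAt hderiv ((by fun_prop : Continuous fun t : ℝ =>
    (1 - t) * Real.cos (c * t)).intervalIntegrable 0 1)]
  simp only [mul_one, mul_zero, Real.sin_zero, Real.cos_zero, sub_self, zero_mul, zero_div]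
  field_simp
  ring

/-- **The tent transform**: `2∫₀¹ (1 − t) cos(2πyt) dt = sinc(πy)²` (the Fourier transform of the
Fejér kernel is the triangle, read backwards on the real line). [cite: Vaaler1985, §2 (2.29)] -/
theorem two_mul_integral_tent_cos (y : ℝ) :
    2 * ∫ t in (0:ℝ)..1, (1 - t) * Real.cos (2 * π * y * t) = Real.sinc (π * y) ^ 2 := by
  rcases eq_or_ne y 0 with rfl | hy
  · simp only [mul_zero, zero_mul, Real.cos_zero, mul_one, Real.sinc_zero, one_pow]
    rw [intervalIntegral.integral_sub intervalIntegrable_const intervalIntegral.intervalIntegrable_id]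
    simp [integral_id]
    norm_num
  · have hc : 2 * π * y ≠ 0 := by positivity
    rw [integral_one_sub_mul_cos hc, Real.sinc_of_ne_zero (mul_ne_zero Real.pi_ne_zero hy)]
    have hcos : Real.cos (2 * π * y) = 1 - 2 * Real.sin (π * y) ^ 2 := by
      rw [show 2 * π * y = 2 * (π * y) by ring, Real.cos_two_mul, Real.sin_sq]; ring
    rw [hcos, div_pow]
    field_simp
    ring

/-! ## The Dirichlet kernel -/

/-- `2 sin(πt) Σ_{n<N} cos(2π(x+n+1)t) = sin((2x+2N+1)πt) − sin((2x+1)πt)`. [cite: Vaaler1985, Thm. 6 (proof)] -/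
theorem two_mul_sin_mul_sum_cos (x t : ℝ) (N : ℕ) :
    2 * Real.sin (π * t) * ∑ n ∈ Finset.range N, Real.cos (2 * π * (x + (n + 1)) * t) =
      Real.sin ((2 * x + 2 * N + 1) * π * t) - Real.sin ((2 * x + 1) * π * t) := by
  induction N with
  | zero => simp
  | succ N ih =>
    rw [Finset.sum_range_succ, mul_add, ih, Real.two_mul_sin_mul_cos]
    have e1 : π * t - 2 * π * (x + (N + 1)) * t = -((2 * x + 2 * N + 1) * π * t) := by ring
    have e2 : π * t + 2 * π * (x + (N + 1)) * t = (2 * x + 2 * (N + 1 : ℕ) + 1) * π * t := by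
      push_cast; ring
    rw [e1, e2, Real.sin_neg]
    push_cast
    ring

/-- `sin(πt) > 0` on `(0, 1)`. [folklore] -/
private theorem sin_pi_mul_pos {t : ℝ} (ht0 : 0 < t) (ht1 : t < 1) : 0 < Real.sin (π * t) :=
  Real.sin_pos_of_pos_of_lt_pi (by positivity) (by nlinarith [Real.pi_pos])

/-- `2(1 − t) ≤ sin(πt)` for `t ∈ [1/2, 1]`. [cite: Ramare2001LOneApproximateFormulae, Lemma 18 (proof)] -/
theorem two_mul_one_sub_le_sin_pi_mul {t : ℝ} (ht : 1 / 2 ≤ t) (ht1 : t ≤ 1) :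
    2 * (1 - t) ≤ Real.sin (π * t) := by
  have h := two_mul_le_sin_pi_mul (u := 1 - t) (by linarith) (by linarith)
  rwa [show π * (1 - t) = π - π * t by ring, Real.sin_pi_sub] at h

/-- On `(0,1)`: `(1 − t)/sin(πt) ≤ 1/(2t)` and `≤ 1/2`… packaged as `(1−t)|sin(Mπt)|/sin(πt) ≤ max(|M|π/2, 1/2)`;
we only need the cruder `t(1 − t) ≤ sin(πt)/2 · 1`, i.e. `t(1−t)/sin(πt) ≤ 1/2`. [cite: Ramare2001LOneApproximateFormulae, Lemma 18 (proof)] -/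
theorem mul_one_sub_le_half_sin {t : ℝ} (ht0 : 0 ≤ t) (ht1 : t ≤ 1) :
    t * (1 - t) ≤ Real.sin (π * t) / 2 := by
  rcases le_total t (1 / 2) with h | h
  · have := two_mul_le_sin_pi_mul ht0 h
    nlinarith
  · have := two_mul_one_sub_le_sin_pi_mul h ht1
    nlinarith


/-- A measurable function bounded on `(0,1)` is interval integrable on `[0,1]`. [folklore] -/
private theorem intervalIntegrable_of_abs_le {f : ℝ → ℝ} (hf : Measurable f) {C : ℝ}
    (h : ∀ t ∈ Ioo (0:ℝ) 1, |f t| ≤ C) : IntervalIntegrable f volume 0 1 := by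
  rw [intervalIntegrable_iff_integrableOn_Ioo_of_le zero_le_one]
  refine Measure.integrableOn_of_bounded (M := C) measure_Ioo_lt_top.ne hf.aestronglyMeasurable ?_
  rw [ae_restrict_iff' measurableSet_Ioo]
  exact Eventually.of_forall fun t ht => by rw [Real.norm_eq_abs]; exact h t ht

/-- `|(1 − t) sin(Mπt)/sin(πt)| ≤ |M|π/2` on `(0,1)`. [cite: Vaaler1985, Thm. 6 (proof)] -/
theorem abs_dirichletTentIntegrand_le (M : ℝ) {t : ℝ} (ht0 : 0 < t) (ht1 : t < 1) :
    |(1 - t) * Real.sin (M * π * t) / Real.sin (π * t)| ≤ |M| * π / 2 := by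
  have hs := sin_pi_mul_pos ht0 ht1
  have hkey := mul_one_sub_le_half_sin ht0.le ht1.le
  have hsin : |Real.sin (M * π * t)| ≤ |M| * π * t := by
    calc |Real.sin (M * π * t)| ≤ |M * π * t| := Real.abs_sin_le_abs
      _ = |M| * π * t := by rw [abs_mul, abs_mul, abs_of_pos Real.pi_pos, abs_of_pos ht0]
  rw [abs_div, abs_mul, abs_of_pos hs, abs_of_nonneg (by linarith : (0:ℝ) ≤ 1 - t),
    div_le_iff₀ hs]
  calc (1 - t) * |Real.sin (M * π * t)| ≤ (1 - t) * (|M| * π * t) :=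
        mul_le_mul_of_nonneg_left hsin (by linarith)
    _ = |M| * π * (t * (1 - t)) := by ring
    _ ≤ |M| * π * (Real.sin (π * t) / 2) :=
        mul_le_mul_of_nonneg_left hkey (by positivity)
    _ = |M| * π / 2 * Real.sin (π * t) := by ring

/-- Interval integrability of the Dirichlet–tent integrand. [cite: Vaaler1985, Thm. 6 (proof)] -/
theorem intervalIntegrable_dirichletTentIntegrand (M : ℝ) :
    IntervalIntegrable (fun t => (1 - t) * Real.sin (M * π * t) / Real.sin (π * t)) volume 0 1 :=
  intervalIntegrable_of_abs_le (by fun_prop) fun t ht => abs_dirichletTentIntegrand_le M ht.1 ht.2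

/-- **Partial sums of the shifted Fejér kernel as Dirichlet–tent integrals**:
`Σ_{n<N} sinc(π(x+n+1))² = F(2x+2N+1) − F(2x+1)`, `F(M) = ∫₀¹ (1−t) sin(Mπt)/sin(πt) dt`. [cite: Vaaler1985, Thm. 6 (proof)] -/
theorem sum_sinc_sq_add_eq (x : ℝ) (N : ℕ) :
    ∑ n ∈ Finset.range N, Real.sinc (π * (x + (n + 1))) ^ 2 =
      (∫ t in (0:ℝ)..1, (1 - t) * Real.sin ((2 * x + 2 * N + 1) * π * t) / Real.sin (π * t)) -
        ∫ t in (0:ℝ)..1, (1 - t) * Real.sin ((2 * x + 1) * π * t) / Real.sin (π * t) := by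
  have hterm : ∀ n ∈ Finset.range N, Real.sinc (π * (x + (n + 1))) ^ 2 =
      ∫ t in (0:ℝ)..1, 2 * ((1 - t) * Real.cos (2 * π * (x + (n + 1)) * t)) := by
    intro n _
    rw [intervalIntegral.integral_const_mul, two_mul_integral_tent_cos]
  set f : ℕ → ℝ → ℝ := fun n t => 2 * ((1 - t) * Real.cos (2 * π * (x + (n + 1)) * t)) with hf
  have hint : ∀ n ∈ Finset.range N, IntervalIntegrable (f n) volume 0 1 := fun n _ =>
    (by simp only [hf]; fun_prop : Continuous (f n)).intervalIntegrable 0 1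
  rw [Finset.sum_congr rfl hterm]
  change ∑ n ∈ Finset.range N, ∫ t in (0:ℝ)..1, f n t = _
  rw [← intervalIntegral.integral_finsetSum hint,
    ← intervalIntegral.integral_sub (intervalIntegrable_dirichletTentIntegrand _)
      (intervalIntegrable_dirichletTentIntegrand _)]
  refine intervalIntegral.integral_congr_ae (Eventually.of_forall fun t ht => ?_)
  simp only [hf]
  rw [uIoc_of_le zero_le_one] at ht
  rcases ht.2.eq_or_lt with rfl | ht1
  · simp
  · have hs := sin_pi_mul_pos ht.1 ht1
    have hk := two_mul_sin_mul_sum_cos x t N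
    have e : (1 - t) * Real.sin ((2 * x + 2 * N + 1) * π * t) / Real.sin (π * t) -
        (1 - t) * Real.sin ((2 * x + 1) * π * t) / Real.sin (π * t) =
        (1 - t) * (2 * Real.sin (π * t) * ∑ n ∈ Finset.range N,
          Real.cos (2 * π * (x + (n + 1)) * t)) / Real.sin (π * t) := by
      rw [hk]; ring
    rw [e, eq_div_iff hs.ne']
    simp only [Finset.mul_sum, Finset.sum_mul]
    exact Finset.sum_congr rfl fun n _ => by ring

/-- The remainder `(1−t)/sin(πt) − 1/(πt)` is bounded by `3` on `(0,1)`. [cite: Vaaler1985, Thm. 6 (proof)] -/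
theorem abs_tentRemainder_le {t : ℝ} (ht0 : 0 < t) (ht1 : t < 1) :
    |(1 - t) / Real.sin (π * t) - 1 / (π * t)| ≤ 3 := by
  have hs := sin_pi_mul_pos ht0 ht1
  have hπt : 0 < π * t := by positivity
  rcases le_or_gt t (1 / 4) with h4 | h4
  · have hle1 : π * t ≤ 1 := by nlinarith [Real.pi_lt_d2]
    have hcube := Real.sin_gt_sub_cube hπt
    have hsinle : Real.sin (π * t) ≤ π * t := Real.sin_le hπt.le
    have h2t := two_mul_le_sin_pi_mul ht0.le (by linarith)
    rw [div_sub_div _ _ hs.ne' hπt.ne', abs_div, abs_of_pos (mul_pos hs hπt),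
      div_le_iff₀ (mul_pos hs hπt)]
    have hp3 : 0 < (π * t) ^ 3 := pow_pos hπt 3
    have hnum : |(1 - t) * (π * t) - Real.sin (π * t) * 1| ≤ (π * t) ^ 3 / 6 + π * t ^ 2 := by
      rw [abs_le]; constructor <;> nlinarith
    have ht3 : (π * t) ^ 3 / 6 + π * t ^ 2 ≤ 3 * (2 * t * (π * t)) := by
      have hπ := Real.pi_lt_d2
      have e : (π * t) ^ 3 = π * t ^ 2 * (π * (π * t)) := by ring
      have h5 : π * (π * t) ≤ 4 := by nlinarith
      have h6 : 0 < π * t ^ 2 := by positivity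
      rw [e]
      nlinarith
    calc |(1 - t) * (π * t) - Real.sin (π * t) * 1| ≤ (π * t) ^ 3 / 6 + π * t ^ 2 := hnum
      _ ≤ 3 * (2 * t * (π * t)) := ht3
      _ ≤ 3 * (Real.sin (π * t) * (π * t)) := by gcongr
  · have hB' : 1 / (π * t) ≤ 4 / 3 := by
      rw [div_le_div_iff₀ hπt (by norm_num)]; nlinarith [Real.pi_gt_three]
    have hB : 0 ≤ 1 / (π * t) := by positivity
    have hA : 0 ≤ (1 - t) / Real.sin (π * t) := div_nonneg (by linarith) hs.le
    have hA' : (1 - t) / Real.sin (π * t) ≤ 3 / 2 := by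
      rw [div_le_div_iff₀ hs (by norm_num)]
      rcases le_total t (1 / 2) with h | h
      · have := two_mul_le_sin_pi_mul ht0.le h
        nlinarith
      · have := two_mul_one_sub_le_sin_pi_mul h ht1.le
        nlinarith
    rw [abs_le]; constructor <;> linarith

/-- **Dirichlet–tent limit**: `∫₀¹ (1−t) sin(Mπt)/sin(πt) dt → 1/2` as `M → +∞` (Dirichlet's integral
for the principal part `1/(πt)`, Riemann–Lebesgue for the bounded remainder; tree
`tendsto_intervalIntegral_sin_div_atTop`, `tendsto_integral_Ioi_mul_sin_atTop`). [cite: Vaaler1985, Thm. 6 (proof)] -/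
theorem tendsto_dirichletTentIntegral :
    Tendsto (fun M : ℝ => ∫ t in (0:ℝ)..1, (1 - t) * Real.sin (M * π * t) / Real.sin (π * t))
      atTop (𝓝 (1 / 2)) := by
  set r : ℝ → ℝ := fun t => (1 - t) / Real.sin (π * t) - 1 / (π * t) with hr
  have hrm : Measurable r := by fun_prop
  have hri : IntervalIntegrable r volume 0 1 :=
    intervalIntegrable_of_abs_le hrm fun t ht => abs_tentRemainder_le ht.1 ht.2
  -- (1) the principal part
  have h1 : Tendsto (fun M : ℝ => ∫ t in (0:ℝ)..1, Real.sin (M * π * t) / (π * t)) atTop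
      (𝓝 (1 / 2)) := by
    have hD := (tendsto_intervalIntegral_sin_div_atTop.comp
      (tendsto_id.atTop_mul_const Real.pi_pos)).const_mul (1 / π)
    rw [show (1:ℝ) / 2 = 1 / π * (π / 2) by field_simp]
    refine hD.congr' ?_
    filter_upwards [eventually_gt_atTop 0] with M hM
    simp only [Function.comp_def, id]
    rw [intervalIntegral_sin_div_eq_comp_mul (by positivity : M * π ≠ 0),
      ← intervalIntegral.integral_const_mul]
    refine intervalIntegral.integral_congr fun t _ => ?_
    rcases eq_or_ne t 0 with rfl | ht
    · simp
    · field_simp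
  -- (2) the remainder (Riemann–Lebesgue)
  have h2 : Tendsto (fun M : ℝ => ∫ t in (0:ℝ)..1, r t * Real.sin (M * π * t)) atTop (𝓝 0) := by
    have hh : IntegrableOn ((Ioc (0:ℝ) 1).indicator r) (Ioi 0) := by
      rw [IntegrableOn, integrable_indicator_iff measurableSet_Ioc, IntegrableOn,
        Measure.restrict_restrict measurableSet_Ioc, inter_eq_left.2 Ioc_subset_Ioi_self]
      exact (intervalIntegrable_iff_integrableOn_Ioc_of_le zero_le_one).1 hri
    have hRL := (tendsto_integral_Ioi_mul_sin_atTop hh).comp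
      (tendsto_id.atTop_mul_const Real.pi_pos)
    refine hRL.congr fun M => ?_
    simp only [Function.comp_def, id]
    have : (fun u => (Ioc (0:ℝ) 1).indicator r u * Real.sin (M * π * u)) =
        (Ioc (0:ℝ) 1).indicator (fun u => r u * Real.sin (M * π * u)) := by
      funext u; rw [indicator_mul_left]
    rw [this, setIntegral_indicator measurableSet_Ioc, inter_eq_right.2 Ioc_subset_Ioi_self,
      intervalIntegral.integral_of_le zero_le_one]
  -- (3) combine
  have h3 := h1.add h2
  rw [add_zero] at h3
  refine h3.congr fun M => ?_
  have hi1 : IntervalIntegrable (fun t => Real.sin (M * π * t) / (π * t)) volume 0 1 := by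
    refine intervalIntegrable_of_abs_le (by fun_prop) (C := |M|) fun t ht => ?_
    have hπt : 0 < π * t := mul_pos Real.pi_pos ht.1
    rw [abs_div, abs_of_pos hπt, div_le_iff₀ hπt]
    calc |Real.sin (M * π * t)| ≤ |M * π * t| := Real.abs_sin_le_abs
      _ = |M| * (π * t) := by rw [abs_mul, abs_mul, abs_of_pos Real.pi_pos, abs_of_pos ht.1]; ring
  have hi2 : IntervalIntegrable (fun t => r t * Real.sin (M * π * t)) volume 0 1 := by
    refine intervalIntegrable_of_abs_le (hrm.mul (by fun_prop)) (C := 3) fun t ht => ?_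
    rw [abs_mul]
    calc |r t| * |Real.sin (M * π * t)| ≤ 3 * 1 :=
        mul_le_mul (abs_tentRemainder_le ht.1 ht.2) (Real.abs_sin_le_one _) (abs_nonneg _)
          (by norm_num)
      _ = 3 := by norm_num
  rw [← intervalIntegral.integral_add hi1 hi2]
  refine intervalIntegral.integral_congr fun t _ => ?_
  simp only [hr]
  ring


/-! ## The shifted Fejér series and Vaaler's `H = B − K` as an integral -/

/-- **`Σ_{n≥1} sinc(π(x+n))² = 1/2 − ∫₀¹ (1−t) sin((2x+1)πt)/sin(πt) dt`** for every real `x`. [cite: Vaaler1985, Thm. 6 (proof)] -/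
theorem hasSum_sinc_sq_add_dirichlet (x : ℝ) :
    HasSum (fun n : ℕ => Real.sinc (π * (x + (n + 1))) ^ 2)
      (1 / 2 - ∫ t in (0:ℝ)..1, (1 - t) * Real.sin ((2 * x + 1) * π * t) / Real.sin (π * t)) := by
  rw [(summable_sinc_sq_add x).hasSum_iff_tendsto_nat]
  have h1 : Tendsto (fun N : ℕ => (2 * x + 2 * (N : ℝ) + 1)) atTop atTop :=
    tendsto_atTop_add_const_right _ _ (tendsto_atTop_add_const_left _ _
      (tendsto_natCast_atTop_atTop.const_mul_atTop two_pos))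
  have h2 := (tendsto_dirichletTentIntegral.comp h1).sub_const
    (∫ t in (0:ℝ)..1, (1 - t) * Real.sin ((2 * x + 1) * π * t) / Real.sin (π * t))
  refine h2.congr fun N => ?_
  simp only [Function.comp_def]
  exact (sum_sinc_sq_add_eq x N).symm

/-- `|(1−t)(cos(πt)/sin(πt)) sin(2πxt)| ≤ π|x|` on `(0,1)`. [cite: Vaaler1985, Thm. 6 (proof)] -/
theorem abs_cotTentIntegrand_le (x : ℝ) {t : ℝ} (ht0 : 0 < t) (ht1 : t < 1) :
    |(1 - t) * (Real.cos (π * t) / Real.sin (π * t)) * Real.sin (2 * π * x * t)| ≤ π * |x| := by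
  have hs := sin_pi_mul_pos ht0 ht1
  have hkey := mul_one_sub_le_half_sin ht0.le ht1.le
  have hsin : |Real.sin (2 * π * x * t)| ≤ 2 * π * |x| * t := by
    calc |Real.sin (2 * π * x * t)| ≤ |2 * π * x * t| := Real.abs_sin_le_abs
      _ = 2 * π * |x| * t := by
          rw [abs_mul, abs_mul, abs_mul, abs_of_pos Real.pi_pos, abs_of_pos ht0, abs_two]
  have e : (1 - t) * (Real.cos (π * t) / Real.sin (π * t)) * Real.sin (2 * π * x * t) =
      (1 - t) * Real.cos (π * t) * Real.sin (2 * π * x * t) / Real.sin (π * t) := by ring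
  rw [e, abs_div, abs_of_pos hs, div_le_iff₀ hs, abs_mul, abs_mul,
    abs_of_nonneg (by linarith : (0:ℝ) ≤ 1 - t)]
  calc (1 - t) * |Real.cos (π * t)| * |Real.sin (2 * π * x * t)|
      ≤ (1 - t) * 1 * (2 * π * |x| * t) :=
        mul_le_mul (mul_le_mul_of_nonneg_left (Real.abs_cos_le_one _) (by linarith)) hsin
          (abs_nonneg _) (by linarith)
    _ = 2 * π * |x| * (t * (1 - t)) := by ring
    _ ≤ 2 * π * |x| * (Real.sin (π * t) / 2) := by gcongr
    _ = π * |x| * Real.sin (π * t) := by ring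

/-- Interval integrability of `(1−t) cot(πt) sin(2πxt)` on `[0,1]`. [cite: Vaaler1985, Thm. 6 (proof)] -/
theorem intervalIntegrable_cotTentIntegrand (x : ℝ) :
    IntervalIntegrable (fun t => (1 - t) * (Real.cos (π * t) / Real.sin (π * t)) *
      Real.sin (2 * π * x * t)) volume 0 1 :=
  intervalIntegrable_of_abs_le (by fun_prop) fun t ht => abs_cotTentIntegrand_le x ht.1 ht.2

/-- `∫₀¹ (1−t) sin((2x+1)πt)/sin(πt) dt = sinc(πx)²/2 + ∫₀¹ (1−t) cot(πt) sin(2πxt) dt`. [cite: Vaaler1985, Thm. 6 (proof)] -/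
theorem dirichletTentIntegral_two_mul_add_one (x : ℝ) :
    ∫ t in (0:ℝ)..1, (1 - t) * Real.sin ((2 * x + 1) * π * t) / Real.sin (π * t) =
      Real.sinc (π * x) ^ 2 / 2 +
        ∫ t in (0:ℝ)..1, (1 - t) * (Real.cos (π * t) / Real.sin (π * t)) * Real.sin (2 * π * x * t) := by
  have ht := two_mul_integral_tent_cos x
  rw [show Real.sinc (π * x) ^ 2 / 2 = ∫ t in (0:ℝ)..1, (1 - t) * Real.cos (2 * π * x * t) by
    rw [← ht]; ring,
    ← intervalIntegral.integral_add ((by fun_prop : Continuous fun t : ℝ =>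
      (1 - t) * Real.cos (2 * π * x * t)).intervalIntegrable 0 1) (intervalIntegrable_cotTentIntegrand x)]
  refine intervalIntegral.integral_congr_ae (Eventually.of_forall fun t ht => ?_)
  rw [uIoc_of_le zero_le_one] at ht
  rcases ht.2.eq_or_lt with rfl | ht1
  · simp
  · have hs := sin_pi_mul_pos ht.1 ht1
    have hs' : Real.sin (π * t) ≠ 0 := hs.ne'
    have : Real.sin ((2 * x + 1) * π * t) =
        Real.sin (2 * π * x * t) * Real.cos (π * t) + Real.cos (2 * π * x * t) * Real.sin (π * t) := by
      rw [show (2 * x + 1) * π * t = 2 * π * x * t + π * t by ring, Real.sin_add]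
    rw [this, div_eq_mul_inv, div_eq_mul_inv]
    have h1 : Real.sin (π * t) * (Real.sin (π * t))⁻¹ = 1 := mul_inv_cancel₀ hs'
    linear_combination ((1 - t) * Real.cos (2 * π * x * t)) * h1

/-- **Vaaler's `H = B − K` on the real line as an integral**:
`B(x) − sinc(πx)² = 2x·sinc(πx)² + 2∫₀¹ (1−t) cot(πt) sin(2πxt) dt`. Here `B` is Beurling's function
(`beurlingReal`), `K(x) = sinc(πx)²` the Fejér kernel, and `H = B − K` is Vaaler's odd entire
approximation of `sgn` of exponential type `2π` (Vaaler 1985, (2.22)–(2.23): `H + K = B`).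
[cite: Vaaler1985, §2 (2.23) and Thm. 6] -/
theorem beurlingReal_sub_sinc_sq (x : ℝ) :
    beurlingReal x - Real.sinc (π * x) ^ 2 = 2 * x * Real.sinc (π * x) ^ 2 +
      2 * ∫ t in (0:ℝ)..1, (1 - t) * (Real.cos (π * t) / Real.sin (π * t)) * Real.sin (2 * π * x * t) := by
  rw [beurlingReal, (hasSum_sinc_sq_add_dirichlet x).tsum_eq, dirichletTentIntegral_two_mul_add_one]
  ring

/-! ## The derivative `H′ = W`, `W(x) = 4∫₀¹ (t + πt(1−t)cot(πt)) cos(2πxt) dt` (Vaaler's Theorem 6) -/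

/-- `∫₀¹ t cos(c t) dt = sin(c)/c + (cos c − 1)/c²` for `c ≠ 0`. [cite: Vaaler1985, Thm. 6 (proof)] -/
theorem integral_id_mul_cos_const_mul {c : ℝ} (hc : c ≠ 0) :
    ∫ t in (0:ℝ)..1, t * Real.cos (c * t) = Real.sin c / c + (Real.cos c - 1) / c ^ 2 := by
  have hderiv : ∀ t ∈ uIcc (0:ℝ) 1,
      HasDerivAt (fun t => t * Real.sin (c * t) / c + Real.cos (c * t) / c ^ 2)
        (t * Real.cos (c * t)) t := by
    intro t _
    have h1 : HasDerivAt (fun t => Real.sin (c * t)) (Real.cos (c * t) * c) t :=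
      ((hasDerivAt_id t).const_mul c |>.sin).congr_deriv (by simp [mul_comm])
    have h2 : HasDerivAt (fun t => Real.cos (c * t)) (-Real.sin (c * t) * c) t :=
      ((hasDerivAt_id t).const_mul c |>.cos).congr_deriv (by simp [mul_comm])
    have h4 := (((hasDerivAt_id t).mul h1).div_const c).add (h2.div_const (c ^ 2))
    refine h4.congr_deriv ?_
    simp only [id]
    field_simp
    ring
  rw [integral_eq_sub_of_hasDerivAt hderiv ((by fun_prop : Continuous fun t : ℝ =>
    t * Real.cos (c * t)).intervalIntegrable 0 1)]
  simp only [mul_one, mul_zero, Real.sin_zero, Real.cos_zero, zero_div, zero_add]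
  ring

/-- `4∫₀¹ t cos(2πxt) dt = 4 cos(πx) sinc(πx) − 2 sinc(πx)²` for every real `x`. [cite: Vaaler1985, Thm. 6 (proof)] -/
theorem four_mul_integral_id_mul_cos (x : ℝ) :
    4 * ∫ t in (0:ℝ)..1, t * Real.cos (2 * π * x * t) =
      4 * Real.cos (π * x) * Real.sinc (π * x) - 2 * Real.sinc (π * x) ^ 2 := by
  rcases eq_or_ne x 0 with rfl | hx
  · simp [integral_id]; norm_num
  · have hc : 2 * π * x ≠ 0 := by positivity
    have hπx : π * x ≠ 0 := mul_ne_zero Real.pi_ne_zero hx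
    rw [integral_id_mul_cos_const_mul hc, Real.sinc_of_ne_zero hπx]
    have hcos : Real.cos (2 * π * x) = 1 - 2 * Real.sin (π * x) ^ 2 := by
      rw [show 2 * π * x = 2 * (π * x) by ring, Real.cos_two_mul, Real.sin_sq]; ring
    have hsin : Real.sin (2 * π * x) = 2 * Real.sin (π * x) * Real.cos (π * x) := by
      rw [show 2 * π * x = 2 * (π * x) by ring, Real.sin_two_mul]
    rw [hcos, hsin]
    field_simp
    ring

/-- The derivative of `x ↦ 2x·sinc(πx)²` is `4cos(πx)sinc(πx) − 2sinc(πx)²`. [cite: Vaaler1985, Thm. 6 (proof)] -/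
theorem hasDerivAt_two_mul_id_mul_sinc_sq (x : ℝ) :
    HasDerivAt (fun x : ℝ => 2 * x * Real.sinc (π * x) ^ 2)
      (4 * Real.cos (π * x) * Real.sinc (π * x) - 2 * Real.sinc (π * x) ^ 2) x := by
  rcases eq_or_ne x 0 with rfl | hx
  · -- at the origin: product rule with the differentiable `sinc`
    have hsinc : Differentiable ℝ Real.sinc := contDiff_sinc.differentiable (by simp)
    have hd : DifferentiableAt ℝ (fun x : ℝ => Real.sinc (π * x) ^ 2) 0 := by fun_prop
    have h := ((hasDerivAt_id (0:ℝ)).const_mul 2).fun_mul hd.hasDerivAt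
    simp only [id, mul_zero, Real.sinc_zero, one_pow, mul_one, zero_mul, add_zero,
      Real.cos_zero] at h ⊢
    exact h.congr_deriv (by norm_num)
  · -- off the origin: `2x sinc(πx)² = 2 sin²(πx)/(π² x)` near `x`
    have hev : (fun y : ℝ => 2 * y * Real.sinc (π * y) ^ 2) =ᶠ[𝓝 x]
        fun y => 2 * Real.sin (π * y) ^ 2 / (π ^ 2 * y) := by
      filter_upwards [isOpen_ne.mem_nhds hx] with y hy
      rw [Real.sinc_of_ne_zero (mul_ne_zero Real.pi_ne_zero hy)]
      field_simp
    rw [hev.hasDerivAt_iff]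
    have h1 : HasDerivAt (fun y => Real.sin (π * y)) (Real.cos (π * x) * π) x :=
      ((hasDerivAt_id x).const_mul π |>.sin).congr_deriv (by simp [mul_comm])
    have h2 := ((h1.fun_pow 2).const_mul 2).fun_div (((hasDerivAt_id x).const_mul (π ^ 2)))
      (by simpa using mul_ne_zero (pow_ne_zero 2 Real.pi_ne_zero) hx)
    refine h2.congr_deriv ?_
    rw [Real.sinc_of_ne_zero (mul_ne_zero Real.pi_ne_zero hx)]
    simp only [id]
    field_simp
    ring

/-- `|t(1−t) cos(πt)/sin(πt)| ≤ 1/2` on `(0,1)`. [cite: Ramare2001LOneApproximateFormulae, Lemma 7 (proof: «cot(πu) ≤ 1/(πu)»)] -/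
theorem abs_mul_one_sub_mul_cot_le {t : ℝ} (ht0 : 0 < t) (ht1 : t < 1) :
    |t * (1 - t) * (Real.cos (π * t) / Real.sin (π * t))| ≤ 1 / 2 := by
  have hs := sin_pi_mul_pos ht0 ht1
  have hkey := mul_one_sub_le_half_sin ht0.le ht1.le
  rw [show t * (1 - t) * (Real.cos (π * t) / Real.sin (π * t)) =
      t * (1 - t) * Real.cos (π * t) / Real.sin (π * t) by ring, abs_div, abs_of_pos hs,
    div_le_iff₀ hs, abs_mul, abs_of_nonneg (by nlinarith : 0 ≤ t * (1 - t))]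
  calc t * (1 - t) * |Real.cos (π * t)| ≤ Real.sin (π * t) / 2 * 1 :=
        mul_le_mul hkey (Real.abs_cos_le_one _) (abs_nonneg _) (by positivity)
    _ = 1 / 2 * Real.sin (π * t) := by ring

/-- Differentiation under the integral: the `x`-derivative of `2∫₀¹ (1−t)cot(πt) sin(2πxt) dt` is
`4π ∫₀¹ t(1−t)cot(πt) cos(2πxt) dt`. [cite: Vaaler1985, Thm. 6 (proof)] -/
theorem hasDerivAt_integral_cotTent (x₀ : ℝ) :
    HasDerivAt (fun x : ℝ => 2 * ∫ t in (0:ℝ)..1,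
        (1 - t) * (Real.cos (π * t) / Real.sin (π * t)) * Real.sin (2 * π * x * t))
      (4 * π * ∫ t in (0:ℝ)..1,
        t * (1 - t) * (Real.cos (π * t) / Real.sin (π * t)) * Real.cos (2 * π * x₀ * t)) x₀ := by
  set F : ℝ → ℝ → ℝ := fun x t =>
    (1 - t) * (Real.cos (π * t) / Real.sin (π * t)) * Real.sin (2 * π * x * t) with hF
  set F' : ℝ → ℝ → ℝ := fun x t =>
    (1 - t) * (Real.cos (π * t) / Real.sin (π * t)) * (Real.cos (2 * π * x * t) * (2 * π * t)) with hF'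
  have hmeas : ∀ x, AEStronglyMeasurable (F x) (volume.restrict (uIoc (0:ℝ) 1)) := fun x =>
    (by simp only [hF]; fun_prop : Measurable (F x)).aestronglyMeasurable
  have hmeas' : ∀ x, AEStronglyMeasurable (F' x) (volume.restrict (uIoc (0:ℝ) 1)) := fun x =>
    (by simp only [hF']; fun_prop : Measurable (F' x)).aestronglyMeasurable
  have hbound : ∀ᵐ t ∂volume, t ∈ uIoc (0:ℝ) 1 → ∀ x ∈ (univ : Set ℝ), ‖F' x t‖ ≤ π := by
    refine Eventually.of_forall fun t ht x _ => ?_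
    rw [uIoc_of_le zero_le_one] at ht
    rcases ht.2.eq_or_lt with rfl | ht1
    · simp [hF', Real.pi_pos.le]
    · simp only [hF', Real.norm_eq_abs]
      have hb := abs_mul_one_sub_mul_cot_le ht.1 ht1
      have e : (1 - t) * (Real.cos (π * t) / Real.sin (π * t)) * (Real.cos (2 * π * x * t) * (2 * π * t)) =
          2 * π * (t * (1 - t) * (Real.cos (π * t) / Real.sin (π * t))) * Real.cos (2 * π * x * t) := by
        ring
      rw [e, abs_mul, abs_mul, abs_of_pos (by positivity : (0:ℝ) < 2 * π)]
      calc 2 * π * |t * (1 - t) * (Real.cos (π * t) / Real.sin (π * t))| * |Real.cos (2 * π * x * t)|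
          ≤ 2 * π * (1 / 2) * 1 := by
            gcongr
            exact Real.abs_cos_le_one _
        _ = π := by ring
  have hderiv : ∀ᵐ t ∂volume, t ∈ uIoc (0:ℝ) 1 → ∀ x ∈ (univ : Set ℝ), HasDerivAt (fun x => F x t) (F' x t) x := by
    refine Eventually.of_forall fun t _ x _ => ?_
    simp only [hF, hF']
    have h1 : HasDerivAt (fun x : ℝ => Real.sin (2 * π * x * t)) (Real.cos (2 * π * x * t) * (2 * π * t)) x := by
      have := ((hasDerivAt_id x).const_mul (2 * π * t)).sin
      refine (this.congr_deriv ?_).congr_of_eventuallyEq ?_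
      · simp only [id]; ring_nf
      · exact Eventually.of_forall fun y => by simp only [id]; ring_nf
    exact h1.const_mul _
  have key := intervalIntegral.hasDerivAt_integral_of_dominated_loc_of_deriv_le (μ := volume)
    (a := (0:ℝ)) (b := 1) (F := F) (F' := F') (x₀ := x₀) (s := univ) (bound := fun _ => π)
    univ_mem (Eventually.of_forall hmeas) (intervalIntegrable_cotTentIntegrand x₀) (hmeas' x₀)
    hbound intervalIntegrable_const hderiv
  have h2 := key.2.const_mul 2
  refine h2.congr_deriv ?_
  rw [show (4 : ℝ) * π = 2 * (2 * π) by ring, mul_assoc, ← intervalIntegral.integral_const_mul (2 * π)]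
  congr 1
  refine intervalIntegral.integral_congr fun t _ => ?_
  simp only [hF']
  ring


/-- `|t + πt(1−t)cot(πt)| ≤ 3` on `(0,1)` (Vaaler's `φ̂`-weight is bounded). [cite: Vaaler1985, Thm. 6] -/
theorem abs_vaalerWeight_le {t : ℝ} (ht0 : 0 < t) (ht1 : t < 1) :
    |t + π * t * (1 - t) * (Real.cos (π * t) / Real.sin (π * t))| ≤ 3 := by
  have h := abs_mul_one_sub_mul_cot_le ht0 ht1
  have e : π * t * (1 - t) * (Real.cos (π * t) / Real.sin (π * t)) =
      π * (t * (1 - t) * (Real.cos (π * t) / Real.sin (π * t))) := by ring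
  rw [e]
  calc |t + π * (t * (1 - t) * (Real.cos (π * t) / Real.sin (π * t)))|
      ≤ |t| + |π * (t * (1 - t) * (Real.cos (π * t) / Real.sin (π * t)))| := abs_add_le _ _
    _ ≤ 1 + π * (1 / 2) := by
        rw [abs_of_pos ht0, abs_mul, abs_of_pos Real.pi_pos]
        gcongr
    _ ≤ 3 := by nlinarith [Real.pi_lt_d2]

/-- Interval integrability of the `W`-integrand. [cite: Vaaler1985, Thm. 6] -/
theorem intervalIntegrable_vaalerWIntegrand (x : ℝ) :
    IntervalIntegrable (fun t => (t + π * t * (1 - t) * (Real.cos (π * t) / Real.sin (π * t))) *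
      Real.cos (2 * π * x * t)) volume 0 1 := by
  refine intervalIntegrable_of_abs_le (by fun_prop) (C := 3) fun t ht => ?_
  rw [abs_mul]
  calc |t + π * t * (1 - t) * (Real.cos (π * t) / Real.sin (π * t))| * |Real.cos (2 * π * x * t)|
      ≤ 3 * 1 := mul_le_mul (abs_vaalerWeight_le ht.1 ht.2) (Real.abs_cos_le_one _) (abs_nonneg _)
        (by norm_num)
    _ = 3 := by norm_num

/-- **Vaaler's Theorem 6 (real form): `H′ = W`**, where `H = B − K` and
`W(x) = 4∫₀¹ (t + πt(1−t)cot(πt)) cos(2πxt) dt = ∫_{−1}^{1} (2|t| + 2πt(1−|t|)cot πt) e(xt) dt`; that is,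
`J = ½H′` is the inverse Fourier transform of `Ĵ(t) = πt(1−|t|)cot πt + |t|` on `(−1,1)` (Vaaler 1985,
Thm 6, eq. (2.30)). Proof: differentiate the integral representation `beurlingReal_sub_sinc_sq`.
[cite: Vaaler1985, Thm. 6] -/
theorem hasDerivAt_beurlingReal_sub_sinc_sq (x : ℝ) :
    HasDerivAt (fun x : ℝ => beurlingReal x - Real.sinc (π * x) ^ 2)
      (4 * ∫ t in (0:ℝ)..1, (t + π * t * (1 - t) * (Real.cos (π * t) / Real.sin (π * t))) *
        Real.cos (2 * π * x * t)) x := by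
  have hfun : (fun x : ℝ => beurlingReal x - Real.sinc (π * x) ^ 2) = fun x =>
      2 * x * Real.sinc (π * x) ^ 2 + 2 * ∫ t in (0:ℝ)..1,
        (1 - t) * (Real.cos (π * t) / Real.sin (π * t)) * Real.sin (2 * π * x * t) :=
    funext beurlingReal_sub_sinc_sq
  rw [hfun]
  have h := (hasDerivAt_two_mul_id_mul_sinc_sq x).add (hasDerivAt_integral_cotTent x)
  refine h.congr_deriv ?_
  rw [← four_mul_integral_id_mul_cos x, mul_assoc 4 π, ← intervalIntegral.integral_const_mul π,
    ← mul_add, ← intervalIntegral.integral_add ((by fun_prop : Continuous fun t : ℝ =>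
      t * Real.cos (2 * π * x * t)).intervalIntegrable 0 1) ?_]
  · congr 1
    refine intervalIntegral.integral_congr fun t _ => ?_
    ring
  · have := (intervalIntegrable_vaalerWIntegrand x).sub ((by fun_prop : Continuous fun t : ℝ =>
      t * Real.cos (2 * π * x * t)).intervalIntegrable 0 1)
    refine this.congr fun t _ => ?_
    ring

/-- **`W(0) = 2`** (`= H′(0)`; equivalently `∫₀¹ t(1−t)cot(πt) dt = 0` by `t ↦ 1−t`).
[cite: Vaaler1985, Thm. 6] -/
theorem vaalerW_zero :
    4 * ∫ t in (0:ℝ)..1, (t + π * t * (1 - t) * (Real.cos (π * t) / Real.sin (π * t))) *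
      Real.cos (2 * π * 0 * t) = 2 := by
  have hsym : ∫ t in (0:ℝ)..1, t * (1 - t) * (Real.cos (π * t) / Real.sin (π * t)) = 0 := by
    set g : ℝ → ℝ := fun t => t * (1 - t) * (Real.cos (π * t) / Real.sin (π * t)) with hg
    have h1 : ∫ t in (0:ℝ)..1, g (1 - t) = ∫ t in (0:ℝ)..1, g t := by
      rw [intervalIntegral.integral_comp_sub_left g (1:ℝ)]
      norm_num
    have h2 : ∀ t, g (1 - t) = -g t := by
      intro t
      simp only [hg]
      rw [show π * (1 - t) = π - π * t by ring, Real.cos_pi_sub, Real.sin_pi_sub]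
      ring
    simp_rw [h2, intervalIntegral.integral_neg] at h1
    linarith
  have hint : IntervalIntegrable (fun t => t * (1 - t) * (Real.cos (π * t) / Real.sin (π * t)))
      volume 0 1 :=
    intervalIntegrable_of_abs_le (by fun_prop) (C := 1 / 2) fun t ht =>
      abs_mul_one_sub_mul_cot_le ht.1 ht.2
  simp only [mul_zero, zero_mul, Real.cos_zero, mul_one]
  have e : (fun t : ℝ => t + π * t * (1 - t) * (Real.cos (π * t) / Real.sin (π * t))) =
      fun t => t + π * (t * (1 - t) * (Real.cos (π * t) / Real.sin (π * t))) := by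
    funext t; ring
  rw [e, intervalIntegral.integral_add intervalIntegral.intervalIntegrable_id (hint.const_mul π),
    intervalIntegral.integral_const_mul, hsym, integral_id]
  norm_num

/-- **`|W(x)| ≤ 12`** for every real `x`. [cite: Vaaler1985, Thm. 6] -/
theorem abs_vaalerW_le (x : ℝ) :
    |4 * ∫ t in (0:ℝ)..1, (t + π * t * (1 - t) * (Real.cos (π * t) / Real.sin (π * t))) *
      Real.cos (2 * π * x * t)| ≤ 12 := by
  rw [abs_mul, abs_of_pos (by norm_num : (0:ℝ) < 4)]
  have h := intervalIntegral.norm_integral_le_of_norm_le_const (a := (0:ℝ)) (b := 1) (C := 3)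
    (f := fun t => (t + π * t * (1 - t) * (Real.cos (π * t) / Real.sin (π * t))) *
      Real.cos (2 * π * x * t)) fun t ht => ?_
  · rw [Real.norm_eq_abs] at h
    linarith
  · rw [uIoc_of_le zero_le_one] at ht
    rw [Real.norm_eq_abs, abs_mul]
    rcases ht.2.eq_or_lt with rfl | ht1
    · simp only [mul_one, sub_self, mul_zero, Real.sin_pi, div_zero, add_zero, abs_one, one_mul]
      exact (Real.abs_cos_le_one _).trans (by norm_num)
    · calc |t + π * t * (1 - t) * (Real.cos (π * t) / Real.sin (π * t))| * |Real.cos (2 * π * x * t)|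
          ≤ 3 * 1 := mul_le_mul (abs_vaalerWeight_le ht.1 ht1) (Real.abs_cos_le_one _)
            (abs_nonneg _) (by norm_num)
        _ = 3 := by norm_num

/-- `W` is even. [cite: Vaaler1985, Thm. 6] -/
theorem vaalerW_neg (x : ℝ) :
    (4 * ∫ t in (0:ℝ)..1, (t + π * t * (1 - t) * (Real.cos (π * t) / Real.sin (π * t))) *
      Real.cos (2 * π * (-x) * t)) =
    4 * ∫ t in (0:ℝ)..1, (t + π * t * (1 - t) * (Real.cos (π * t) / Real.sin (π * t))) *
      Real.cos (2 * π * x * t) := by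
  congr 1
  refine intervalIntegral.integral_congr fun t _ => ?_
  simp only [mul_neg, neg_mul, Real.cos_neg]

/-! ## Decay of `W = H′` from Cauchy's estimate for the entire function `B − sincPi²` -/

/-- The entire function `z ↦ B(z) − sincPi(z)²` restricted to `ℝ` is `H`. [cite: Vaaler1985, §2 (2.23)] -/
theorem beurling_sub_sincPi_sq_ofReal (x : ℝ) :
    beurling x - sincPi x ^ 2 = ((beurlingReal x - Real.sinc (π * x) ^ 2 : ℝ) : ℂ) := by
  rw [beurling_ofReal, sincPi_ofReal]; push_cast; ring

/-- `|H(z) − 1| ≤ 2e^{2π}/(x−1)²` on the circle `|z − x| = 1`, `x ≥ 2`. [cite: Vaaler1985, §1] -/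
theorem norm_beurling_sub_sincPi_sq_sub_one_le {x : ℝ} (hx : 2 ≤ x) {z : ℂ}
    (hz : z ∈ Metric.sphere (x : ℂ) 1) :
    ‖beurling z - sincPi z ^ 2 - 1‖ ≤ 2 * Real.exp (2 * π) / (x - 1) ^ 2 := by
  rw [Metric.mem_sphere, Complex.dist_eq] at hz
  have hre : x - 1 ≤ z.re := by
    have := Complex.abs_re_le_norm (z - x)
    rw [hz, Complex.sub_re, Complex.ofReal_re] at this
    have := (abs_le.1 this).1
    linarith
  have him : |z.im| ≤ 1 := by
    have := Complex.abs_im_le_norm (z - x)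
    rwa [hz, Complex.sub_im, Complex.ofReal_im, sub_zero] at this
  have hx1 : 1 ≤ x - 1 := by linarith
  have hzn : x - 1 ≤ ‖z‖ := le_trans hre (Complex.re_le_norm z)
  have hz1 : 1 ≤ ‖z‖ := le_trans hx1 hzn
  have hz0 : z ≠ 0 := by
    intro h; rw [h, norm_zero] at hz1; linarith
  have hexp : Real.exp (2 * π * |z.im|) ≤ Real.exp (2 * π) := by
    apply Real.exp_le_exp.2; nlinarith [Real.pi_pos]
  have hexp' : Real.exp (π * |z.im|) ^ 2 ≤ Real.exp (2 * π) := by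
    rw [← Real.exp_nat_mul]; push_cast; rw [show (2:ℝ) * (π * |z.im|) = 2 * π * |z.im| by ring]
    exact hexp
  have hB := norm_beurling_sub_one_le (by linarith : 0 ≤ z.re) hz1
  have hS := norm_sincPi_le_div hz0
  have hS2 : ‖sincPi z ^ 2‖ ≤ Real.exp (2 * π) / (x - 1) ^ 2 := by
    rw [norm_pow]
    have h0 : 0 ≤ ‖sincPi z‖ := norm_nonneg _
    calc ‖sincPi z‖ ^ 2 ≤ (Real.exp (π * |z.im|) / (π * ‖z‖)) ^ 2 := by gcongr
      _ = Real.exp (π * |z.im|) ^ 2 / (π ^ 2 * ‖z‖ ^ 2) := by rw [div_pow, mul_pow]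
      _ ≤ Real.exp (2 * π) / (1 * (x - 1) ^ 2) := by
          gcongr
          · nlinarith [Real.pi_gt_three]
      _ = Real.exp (2 * π) / (x - 1) ^ 2 := by rw [one_mul]
  have hB2 : ‖beurling z - 1‖ ≤ Real.exp (2 * π) / (x - 1) ^ 2 := by
    calc ‖beurling z - 1‖ ≤ Real.exp (2 * π * |z.im|) / ‖z‖ ^ 2 := hB
      _ ≤ Real.exp (2 * π) / (x - 1) ^ 2 := by gcongr
  calc ‖beurling z - sincPi z ^ 2 - 1‖ = ‖(beurling z - 1) - sincPi z ^ 2‖ := by ring_nf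
    _ ≤ ‖beurling z - 1‖ + ‖sincPi z ^ 2‖ := norm_sub_le _ _
    _ ≤ Real.exp (2 * π) / (x - 1) ^ 2 + Real.exp (2 * π) / (x - 1) ^ 2 := add_le_add hB2 hS2
    _ = 2 * Real.exp (2 * π) / (x - 1) ^ 2 := by ring

/-- **Decay of `W = H′`**: `|W(x)| ≤ 8e^{2π}/x²` for `|x| ≥ 2` (Cauchy's estimate on the circle of
radius `1` and the growth bounds `|B(z) − 1| ≤ e^{2π|Im z|}/|z|²`, `|sincPi z| ≤ e^{π|Im z|}/(π|z|)`).
[cite: Vaaler1985, Thm. 6] -/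
theorem abs_vaalerW_le_div_sq {x : ℝ} (hx : 2 ≤ |x|) :
    |4 * ∫ t in (0:ℝ)..1, (t + π * t * (1 - t) * (Real.cos (π * t) / Real.sin (π * t))) *
      Real.cos (2 * π * x * t)| ≤ 8 * Real.exp (2 * π) / x ^ 2 := by
  -- reduce to `x ≥ 2` by evenness
  wlog hxp : 2 ≤ x generalizing x
  · have hx' : 2 ≤ -x := by
      rcases le_abs'.1 hx with h | h
      · linarith
      · exact absurd h (not_le.2 (lt_of_not_ge hxp))
    have := this (x := -x) (by rwa [abs_neg]) hx'
    rwa [vaalerW_neg, neg_sq] at this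
  set Hc : ℂ → ℂ := fun z => beurling z - sincPi z ^ 2 with hHc
  have hdiff : Differentiable ℂ Hc := differentiable_beurling.sub (differentiable_sincPi.pow 2)
  -- the real derivative of `H` is the real part of the complex derivative
  have hreal : HasDerivAt (fun y : ℝ => beurlingReal y - Real.sinc (π * y) ^ 2)
      (deriv Hc x).re x := by
    have h := (hdiff (x : ℂ)).hasDerivAt.real_of_complex
    refine h.congr_of_eventuallyEq (Eventually.of_forall fun y => ?_)
    simp only [hHc, beurling_sub_sincPi_sq_ofReal, Complex.ofReal_re]
  have huniq := (hasDerivAt_beurlingReal_sub_sinc_sq x).unique hreal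
  rw [huniq]
  -- Cauchy's estimate for `Hc − 1` on the circle of radius `1` about `x`
  have hC := Complex.norm_deriv_le_of_forall_mem_sphere_norm_le (f := fun z => Hc z - 1)
    (c := (x : ℂ)) (R := 1) one_pos ((hdiff.sub_const 1).diffContOnCl)
    (fun z hz => norm_beurling_sub_sincPi_sq_sub_one_le hxp hz)
  rw [deriv_sub_const, div_one] at hC
  have hx1 : (x - 1) ^ 2 ≥ x ^ 2 / 4 := by nlinarith
  calc |(deriv Hc x).re| ≤ ‖deriv Hc x‖ := Complex.abs_re_le_norm _
    _ ≤ 2 * Real.exp (2 * π) / (x - 1) ^ 2 := hC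
    _ ≤ 2 * Real.exp (2 * π) / (x ^ 2 / 4) := by
        gcongr
    _ = 8 * Real.exp (2 * π) / x ^ 2 := by field_simp; ring

/-- **Global decay**: `|W(x)| ≤ 10e^{2π}/(1 + x²)` for all real `x`. [cite: Vaaler1985, Thm. 6] -/
theorem abs_vaalerW_le_div_one_add_sq (x : ℝ) :
    |4 * ∫ t in (0:ℝ)..1, (t + π * t * (1 - t) * (Real.cos (π * t) / Real.sin (π * t))) *
      Real.cos (2 * π * x * t)| ≤ 10 * Real.exp (2 * π) / (1 + x ^ 2) := by
  have hexp : (6:ℝ) ≤ Real.exp (2 * π) := by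
    have : (2:ℝ) * π ≥ 6 := by nlinarith [Real.pi_gt_three]
    calc (6:ℝ) ≤ 6 + 1 := by norm_num
      _ ≤ 2 * π + 1 := by linarith
      _ ≤ Real.exp (2 * π) := Real.add_one_le_exp _
  rcases le_or_gt 2 |x| with hx | hx
  · have h := abs_vaalerW_le_div_sq hx
    have hx2 : 4 ≤ x ^ 2 := by nlinarith [abs_nonneg x, sq_abs x]
    calc _ ≤ 8 * Real.exp (2 * π) / x ^ 2 := h
      _ ≤ 10 * Real.exp (2 * π) / (1 + x ^ 2) := by
          rw [div_le_div_iff₀ (by positivity) (by positivity)]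
          nlinarith [Real.exp_pos (2 * π)]
  · have h := abs_vaalerW_le x
    have hx2 : x ^ 2 < 4 := by nlinarith [abs_nonneg x, sq_abs x]
    calc _ ≤ (12 : ℝ) := h
      _ ≤ 10 * Real.exp (2 * π) / (1 + x ^ 2) := by
          rw [le_div_iff₀ (by positivity)]
          nlinarith


/-! ## Values and signs of `H` on the half-line: `0 ≤ 1 − H(x) ≤ sinc(πx)²` (`x > 0`), `H(n) = 1` -/

/-- `sinc(πk) = 0` for a natural number `k ≥ 1`. [folklore] -/
private theorem sinc_pi_mul_natCast {k : ℕ} (hk : k ≠ 0) : Real.sinc (π * k) = 0 := by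
  rw [Real.sinc_of_ne_zero (by positivity), mul_comm, Real.sin_nat_mul_pi, zero_div]

/-- **`H(n) = B(n) − sinc(πn)² = 1`** at every positive integer (Vaaler: `H` interpolates `sgn` at
the integers). [cite: Vaaler1985, §2 (2.23)] -/
theorem beurlingReal_sub_sinc_sq_natCast {n : ℕ} (hn : n ≠ 0) :
    beurlingReal n - Real.sinc (π * n) ^ 2 = 1 := by
  rw [beurlingReal, sinc_pi_mul_natCast hn]
  have h : ∀ m : ℕ, Real.sinc (π * ((n : ℝ) + (m + 1))) ^ 2 = 0 := by
    intro m
    have := sinc_pi_mul_natCast (k := n + (m + 1)) (by omega)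
    push_cast at this
    rw [this]; simp
  simp_rw [h]
  simp

/-- **`1 − H(x) ≤ sinc(πx)²` for `x > 0`** (i.e. `B(x) ≥ 1`; Vaaler's Lemma 5 / Ramaré's Lemma 15,
left inequality `1 − (sin πt/πt)² ≤ F₃(t)`). [cite: Vaaler1985, Lemma 5] -/
theorem one_sub_beurlingReal_sub_sinc_sq_le {x : ℝ} (hx : 0 < x) :
    1 - (beurlingReal x - Real.sinc (π * x) ^ 2) ≤ Real.sinc (π * x) ^ 2 := by
  linarith [one_le_beurlingReal hx.le]

/-- **`0 ≤ 1 − H(x)` for `x > 0`** (i.e. `H ≤ 1` on the positive half-line: `B(x) − 1 ≤ sinc(πx)²`,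
by the termwise AM–GM inequality `2/((x+n)(x+n+1)) ≤ (x+n)⁻² + (x+n+1)⁻²`; Ramaré's Lemma 15, right
inequality `F₃ ≤ 1`). [cite: Vaaler1985, Lemma 5] -/
theorem one_sub_beurlingReal_sub_sinc_sq_nonneg {x : ℝ} (hx : 0 < x) :
    0 ≤ 1 - (beurlingReal x - Real.sinc (π * x) ^ 2) := by
  -- the two series
  have hT := hasSum_inv_add_sub_inv_add_succ hx
  have hterm : ∀ n : ℕ, 1 / (x + n) - 1 / (x + n + 1) = 1 / ((x + n) * (x + n + 1)) := by
    intro n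
    have h1 : x + n ≠ 0 := by positivity
    have h2 : x + n + 1 ≠ 0 := by positivity
    field_simp; ring
  have hS : Summable fun n : ℕ => 1 / (x + (n + 1)) ^ 2 := by
    refine Summable.of_nonneg_of_le (fun n => by positivity) (fun n => ?_) hT.summable
    rw [hterm]
    have h1 : (0:ℝ) < x + n := by positivity
    rw [div_le_div_iff₀ (by positivity) (by positivity)]
    nlinarith
  have hS0 : Summable fun n : ℕ => 1 / (x + n) ^ 2 := by
    have : Summable fun n : ℕ => 1 / (x + ((n + 1 : ℕ) : ℝ)) ^ 2 := by
      simpa [Nat.cast_add, Nat.cast_one] using hS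
    exact (summable_nat_add_iff 1).1 this
  -- termwise AM–GM, summed: `1/x ≤ (Σ_{n≥0} (x+n)⁻² + Σ_{n≥0} (x+n+1)⁻²)/2`
  have hAMGM : 1 / x ≤ (∑' n : ℕ, 1 / (x + n) ^ 2 + ∑' n : ℕ, 1 / (x + (n + 1)) ^ 2) / 2 := by
    rw [← hS0.tsum_add hS, ← hT.tsum_eq, le_div_iff₀ two_pos, ← tsum_mul_right]
    refine (hT.summable.mul_right 2).tsum_le_tsum (fun n => ?_) (hS0.add hS)
    rw [hterm]
    have h1 : (0:ℝ) < x + n := by positivity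
    have h2 : (0:ℝ) < x + n + 1 := by positivity
    rw [show x + ((n:ℝ) + 1) = x + n + 1 by ring]
    rw [div_add_div _ _ (pow_ne_zero 2 h1.ne') (pow_ne_zero 2 h2.ne'),
      div_mul_eq_mul_div, div_le_div_iff₀ (by positivity) (by positivity)]
    nlinarith [sq_nonneg ((x + n + 1) - (x + n)), mul_pos h1 h2, sq_nonneg (x + n), sq_nonneg (x+n+1),
      mul_pos (mul_pos h1 h2) (mul_pos h1 h2)]
  have hshift : ∑' n : ℕ, 1 / (x + n) ^ 2 = 1 / x ^ 2 + ∑' n : ℕ, 1 / (x + (n + 1)) ^ 2 := by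
    rw [hS0.tsum_eq_zero_add]
    simp [Nat.cast_add, Nat.cast_one]
  have hB := beurlingReal_sub_one_eq hx
  rw [show beurlingReal x = 1 + 2 * Real.sin (π * x) ^ 2 / π ^ 2 *
      (1 / x - ∑' n : ℕ, 1 / (x + (n + 1)) ^ 2) by linarith [hB],
    Real.sinc_of_ne_zero (mul_ne_zero Real.pi_ne_zero hx.ne')]
  rw [hshift] at hAMGM
  have hsin : 0 ≤ Real.sin (π * x) ^ 2 := sq_nonneg _
  have key : 2 * (1 / x - ∑' n : ℕ, 1 / (x + (n + 1)) ^ 2) ≤ 1 / x ^ 2 := by linarith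
  have e : 1 - (1 + 2 * Real.sin (π * x) ^ 2 / π ^ 2 * (1 / x - ∑' n : ℕ, 1 / (x + (n + 1)) ^ 2) -
      (Real.sin (π * x) / (π * x)) ^ 2) =
      Real.sin (π * x) ^ 2 / π ^ 2 * (1 / x ^ 2 - 2 * (1 / x - ∑' n : ℕ, 1 / (x + (n + 1)) ^ 2)) := by
    field_simp
    ring
  rw [e]
  exact mul_nonneg (by positivity) (by linarith)

end Literature.Analysis.Fourier
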